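import Summits.Ventures.HodgeRepro.Groups
import Summits.Ventures.HodgeRepro.OrbitSizes

/-!
# The eleven census orbit numbers as instances of the twist-class formula (seat `p1`, gen 5)

Blind re-derivation cell `pub-hodge-repro`.  `OrbitCount.lean` proves, for every finite `(G, c)` with `|G| = 2m > 4`,
`8·#orbits = 2^(m−1)(m−1) + ι·2^(m/2)` (`ι` = number of involutions other than `c`), with the evaluations `#orbits = 1`
(`m = 3`), `2·#orbits = 6 + ι` (`m = 4`), `#orbits = 20 + ι` (`m = 6`).  Here the formula is instantiated on the eleven
Galois CM closure types of the sealed census (`Groups.lean`: the Mathlib groups the sealed Cayley tables are identified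
with, with the sealed complex conjugations `cc_*`): the numbers of orbits of type squares on the MODEL side are

* order `6`: `C6` — `1`;
* order `8`: `C8` — `3`, `C4×C2` (square, `c = (2,0)`) — `4`, `C4×C2` (non-square, `c = (0,1)`) — `4`, `C2³` — `6`, `D4` — `5`, `Q8` — `3`;
* order `12`: `C12` — `20`, `C6×C2` (`c = (3,0)`) — `22`, `D6` — `26`, `Dic3` — `20`,

i.e. the sealed `1; 3, 4, 4, 6, 5, 3; 20, 22, 26, 20` — obtained from ONE theorem, the only computation per row being
the count `ι` of involutions (a `decide` over 8 or 12 group elements), independently of the engine's orbit-representative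
search (`squareOrbitRepsFast`).  Likewise the numbers of orbits of size `|G|/2` (`OrbitSizes.lean`, `4·#smallOrbits =
ι·2^(m/2)`): `0; 0, 2, 2, 6, 4, 0; 0, 4, 12, 0` — the sealed orbit-size lists (`ι` orbits of size `4` at order `8`, `2ι`
orbits of size `6` at order `12`).  The engine's orbit numbers are the same numbers on the bitmask model (the sealed
`reps.length` of each row); relating the two models is the `EngineComplete` / `CayleyTable` bridge of the `typer` seats.
-/

open Finset

namespace HodgeRepro.TwistOrbit

/-! ### Order 6 -/

/-- `C6`: one orbit. -/
theorem card_squareOrbits_C6 : (squareOrbits cc_C6).card = 1 :=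
  card_squareOrbits_eq_one cc_C6_isComplexConj (by decide)

/-! ### Order 8 (`2·#orbits = 6 + ι`) -/

/-- `C8` has no involution besides `c`. -/
theorem card_otherInvolutions_C8 : (otherInvolutions cc_C8).card = 0 := by decide

/-- `C8`: `3` orbits. -/
theorem card_squareOrbits_C8 : (squareOrbits cc_C8).card = 3 := by
  have h := card_squareOrbits_of_eq_four cc_C8_isComplexConj (by decide)
  rw [card_otherInvolutions_C8] at h
  omega

/-- `C4×C2`, `c = (2,0)`: two involutions besides `c`. -/
theorem card_otherInvolutions_C4xC2_sq : (otherInvolutions cc_C4xC2_sq).card = 2 := by decide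

/-- `C4×C2` (square): `4` orbits. -/
theorem card_squareOrbits_C4xC2_sq : (squareOrbits cc_C4xC2_sq).card = 4 := by
  have h := card_squareOrbits_of_eq_four cc_C4xC2_sq_isComplexConj (by decide)
  rw [card_otherInvolutions_C4xC2_sq] at h
  omega

/-- `C4×C2`, `c = (0,1)`: two involutions besides `c`. -/
theorem card_otherInvolutions_C4xC2_ns : (otherInvolutions cc_C4xC2_ns).card = 2 := by decide

/-- `C4×C2` (non-square): `4` orbits. -/
theorem card_squareOrbits_C4xC2_ns : (squareOrbits cc_C4xC2_ns).card = 4 := by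
  have h := card_squareOrbits_of_eq_four cc_C4xC2_ns_isComplexConj (by decide)
  rw [card_otherInvolutions_C4xC2_ns] at h
  omega

/-- `C2³`: six involutions besides `c`. -/
theorem card_otherInvolutions_C2xC2xC2 : (otherInvolutions cc_C2xC2xC2).card = 6 := by decide

/-- `C2³`: `6` orbits. -/
theorem card_squareOrbits_C2xC2xC2 : (squareOrbits cc_C2xC2xC2).card = 6 := by
  have h := card_squareOrbits_of_eq_four cc_C2xC2xC2_isComplexConj (by decide)
  rw [card_otherInvolutions_C2xC2xC2] at h
  omega

/-- `D4`: four involutions besides `c = r²` (the four reflections). -/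
theorem card_otherInvolutions_D4 : (otherInvolutions cc_D4).card = 4 := by decide

/-- `D4`: `5` orbits. -/
theorem card_squareOrbits_D4 : (squareOrbits cc_D4).card = 5 := by
  have h := card_squareOrbits_of_eq_four cc_D4_isComplexConj (by decide)
  rw [card_otherInvolutions_D4] at h
  omega

/-- `Q8` has no involution besides `c`. -/
theorem card_otherInvolutions_Q8 : (otherInvolutions cc_Q8).card = 0 := by decide

/-- `Q8`: `3` orbits. -/
theorem card_squareOrbits_Q8 : (squareOrbits cc_Q8).card = 3 := by
  have h := card_squareOrbits_of_eq_four cc_Q8_isComplexConj (by decide)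
  rw [card_otherInvolutions_Q8] at h
  omega

/-! ### Order 12 (`#orbits = 20 + ι`) -/

/-- `C12` has no involution besides `c`. -/
theorem card_otherInvolutions_C12 : (otherInvolutions cc_C12).card = 0 := by decide

/-- `C12`: `20` orbits. -/
theorem card_squareOrbits_C12 : (squareOrbits cc_C12).card = 20 := by
  rw [card_squareOrbits_of_eq_six cc_C12_isComplexConj (by decide), card_otherInvolutions_C12]

/-- `C6×C2`, `c = (3,0)`: two involutions besides `c`. -/
theorem card_otherInvolutions_C6xC2 : (otherInvolutions cc_C6xC2).card = 2 := by decide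

/-- `C6×C2`: `22` orbits. -/
theorem card_squareOrbits_C6xC2 : (squareOrbits cc_C6xC2).card = 22 := by
  rw [card_squareOrbits_of_eq_six cc_C6xC2_isComplexConj (by decide), card_otherInvolutions_C6xC2]

/-- `D6`: six involutions besides `c = r³` (the six reflections). -/
theorem card_otherInvolutions_D6 : (otherInvolutions cc_D6).card = 6 := by decide

/-- `D6`: `26` orbits. -/
theorem card_squareOrbits_D6 : (squareOrbits cc_D6).card = 26 := by
  rw [card_squareOrbits_of_eq_six cc_D6_isComplexConj (by decide), card_otherInvolutions_D6]

/-- `Dic3` has no involution besides `c`. -/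
theorem card_otherInvolutions_Dic3 : (otherInvolutions cc_Dic3).card = 0 := by decide

/-- `Dic3`: `20` orbits. -/
theorem card_squareOrbits_Dic3 : (squareOrbits cc_Dic3).card = 20 := by
  rw [card_squareOrbits_of_eq_six cc_Dic3_isComplexConj (by decide), card_otherInvolutions_Dic3]

/-! ### The orbits of size `|G|/2` -/

/-- `C6`: no orbit of size `3` (the single orbit has size `6`). -/
theorem card_smallOrbits_C6 : (smallOrbits cc_C6).card = 0 := by
  have h := four_mul_card_smallOrbits cc_C6_isComplexConj (by decide)
  rw [show (otherInvolutions cc_C6).card = 0 by decide] at h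
  omega

/-- `C8`: no orbit of size `4`. -/
theorem card_smallOrbits_C8 : (smallOrbits cc_C8).card = 0 := by
  have h := four_mul_card_smallOrbits cc_C8_isComplexConj (by decide)
  rw [card_otherInvolutions_C8] at h
  omega

/-- `C4×C2` (square): `2` orbits of size `4`. -/
theorem card_smallOrbits_C4xC2_sq : (smallOrbits cc_C4xC2_sq).card = 2 := by
  have h := four_mul_card_smallOrbits cc_C4xC2_sq_isComplexConj (by decide)
  rw [card_otherInvolutions_C4xC2_sq, show Fintype.card C4xC2 / 2 / 2 = 2 by decide] at h
  omega

/-- `C4×C2` (non-square): `2` orbits of size `4`. -/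
theorem card_smallOrbits_C4xC2_ns : (smallOrbits cc_C4xC2_ns).card = 2 := by
  have h := four_mul_card_smallOrbits cc_C4xC2_ns_isComplexConj (by decide)
  rw [card_otherInvolutions_C4xC2_ns, show Fintype.card C4xC2 / 2 / 2 = 2 by decide] at h
  omega

/-- `C2³`: `6` orbits of size `4`. -/
theorem card_smallOrbits_C2xC2xC2 : (smallOrbits cc_C2xC2xC2).card = 6 := by
  have h := four_mul_card_smallOrbits cc_C2xC2xC2_isComplexConj (by decide)
  rw [card_otherInvolutions_C2xC2xC2, show Fintype.card C2xC2xC2 / 2 / 2 = 2 by decide] at h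
  omega

/-- `D4`: `4` orbits of size `4`. -/
theorem card_smallOrbits_D4 : (smallOrbits cc_D4).card = 4 := by
  have h := four_mul_card_smallOrbits cc_D4_isComplexConj (by decide)
  rw [card_otherInvolutions_D4, show Fintype.card D4 / 2 / 2 = 2 by decide] at h
  omega

/-- `Q8`: no orbit of size `4`. -/
theorem card_smallOrbits_Q8 : (smallOrbits cc_Q8).card = 0 := by
  have h := four_mul_card_smallOrbits cc_Q8_isComplexConj (by decide)
  rw [card_otherInvolutions_Q8] at h
  omega

/-- `C12`: no orbit of size `6`. -/
theorem card_smallOrbits_C12 : (smallOrbits cc_C12).card = 0 := by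
  have h := four_mul_card_smallOrbits cc_C12_isComplexConj (by decide)
  rw [card_otherInvolutions_C12] at h
  omega

/-- `C6×C2`: `4` orbits of size `6`. -/
theorem card_smallOrbits_C6xC2 : (smallOrbits cc_C6xC2).card = 4 := by
  have h := four_mul_card_smallOrbits cc_C6xC2_isComplexConj (by decide)
  rw [card_otherInvolutions_C6xC2, show Fintype.card C6xC2 / 2 / 2 = 3 by decide] at h
  omega

/-- `D6`: `12` orbits of size `6`. -/
theorem card_smallOrbits_D6 : (smallOrbits cc_D6).card = 12 := by
  have h := four_mul_card_smallOrbits cc_D6_isComplexConj (by decide)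
  rw [card_otherInvolutions_D6, show Fintype.card D6 / 2 / 2 = 3 by decide] at h
  omega

/-- `Dic3`: no orbit of size `6`. -/
theorem card_smallOrbits_Dic3 : (smallOrbits cc_Dic3).card = 0 := by
  have h := four_mul_card_smallOrbits cc_Dic3_isComplexConj (by decide)
  rw [card_otherInvolutions_Dic3] at h
  omega

end HodgeRepro.TwistOrbit
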